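import Mathlib
import Summits.ResolutionOfSingularities.ResolutionOfSingularities.Theorems.RadicialJungCleanModelsCleanProp44VeryNearAscent
import HarnessLib

/-!
# Route `RadicialJung`, crux `CleanModels` (stmt-ResolutionOfSingularities-15917), line `Sketch` rev 35, stub 6 `stub_cleanProp44` (X44c):
# criteria for «no very near point»

Seat decomp-res-hand-2 g15 (structural hand).  The hypothesis «every blowing up of `X` at the closed point `x` has `τ ≥ 2` at its closed
threefold near points» of the g15 theorems (✓ `…TauTwoRegimeLocal`, `…TauOneVeryNear`, `…FiniteStratumVeryNear`, `…IsolatedTauOne`) made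
checkable:

* `forall_near_two_le_of_two_le_stalkTau` — **it holds AUTOMATICALLY at a closed threefold point with `τ_x ≥ 2`** ([CoP1] Lemma 4.3 (1):
  `τ = 3` ⟹ no near point; Lemma 4.3 (3): `τ = 2` ⟹ `τ ≥ 2` at the near point): so it is a condition at `τ = 1` points only.
* `forall_near_two_le_of_isBlowup` — **it suffices to check it on ONE blowing up** (blowing ups are unique up to isomorphism,
  ✓ `IsBlowup.unique`; `τ`, orders, embedding dimension and closedness travel along the isomorphism).

Honest framing: OURS, plumbing; nothing here proves X44c, any case of `CleanModels`, or resolution of singularities in characteristic `p`.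
[cite: CossartPiltant2008, Lemma 4.3 (1) (3)] [cite: GortzWedhorn2020, Def. 13.90, Prop. 13.91]
-/

noncomputable section

set_option linter.dupNamespace false -- mandated namespace of this single-conjunct summit

open CategoryTheory CategoryTheory.Limits AlgebraicGeometry TopologicalSpace IsLocalRing
open Literature.AlgebraicGeometry.Resolution Literature.AlgebraicGeometry.Motives
open Scheme.IdealSheafData
open Summit.ResolutionOfSingularities.ResolutionOfSingularities.Theorems.CP2008Prop44

namespace Summit.ResolutionOfSingularities.ResolutionOfSingularities.Theorems.RadicialJung.CleanModels

set_option maxHeartbeats 800000 in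
-- near-point lemmas
/-- **«No very near point» is automatic at `τ ≥ 2`.**  `X` locally Noetherian, `x` a closed point with regular local ring of embedding dimension `3`,
`μ ≥ 1`, `τ_x(J, μ) ≥ 2`: every blowing up of `X` at `x` has `τ ≥ 2` at its near points over `x` (indeed at all of them, closed or not, of any
embedding dimension, as long as the local ring is regular). [cite: CossartPiltant2008, Lemma 4.3 (1) (3)] -/
theorem forall_near_two_le_of_two_le_stalkTau {X : Scheme.{0}} [IsLocallyNoetherian X] (J : X.IdealSheafData) {μ : ℕ} (hμ : 1 ≤ μ)
    (x : X) (hcl : IsClosed ({x} : Set X)) [hrx : IsRegularLocalRing (X.presheaf.stalk x)]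
    (hdim : (maximalIdeal (X.presheaf.stalk x)).spanFinrank = 3) (hτ : 2 ≤ stalkTau J x μ) :
    ∀ (X₂ : Scheme.{0}) (ϖ : X₂ ⟶ X), IsBlowup ϖ (vanishingIdeal ⟨{x}, hcl⟩) →
      ∀ w : X₂, IsClosed ({w} : Set X₂) → ϖ w = x → idealOrder (controlledTransform ϖ (vanishingIdeal ⟨{x}, hcl⟩) J μ) w = μ →
        (maximalIdeal (X₂.presheaf.stalk w)).spanFinrank = 3 →
        ∀ hr : IsRegularLocalRing (X₂.presheaf.stalk w), 2 ≤ @stalkTau X₂ (controlledTransform ϖ (vanishingIdeal ⟨{x}, hcl⟩) J μ) w hr μ := by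
  intro X₂ ϖ hϖ w _ hw hordw _ hrw
  haveI : IsLocallyNoetherian X₂ := hϖ.isLocallyNoetherian
  subst hw
  have hnear : IsNear ϖ (vanishingIdeal ⟨{ϖ w}, hcl⟩) J μ w := isNear_iff.mpr hordw
  obtain ⟨c3, hc3, hc3Y⟩ := CampaignW46.exists_rsop_three hcl hdim
  have hle2 : stalkTau J (ϖ w) μ ≤ 2 := hϖ.stalkTau_le_two_of_isNear_point hdim hc3 hc3Y hnear
  have hτ2 : stalkTau J (ϖ w) μ = 2 := le_antisymm hle2 hτ
  have hmono := hϖ.stalkTau_le_stalkTau_of_isNear_point hμ hdim hc3 hc3Y hτ2 hnear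
  rw [hτ2] at hmono
  exact hmono

set_option maxHeartbeats 800000 in
-- transport along the isomorphism of two blowing ups
/-- **«No very near point» may be checked on ONE blowing up.**  If some blowing up `π : X₁ → X` of the closed point `x` has `τ ≥ 2` at its closed
threefold near points, then every blowing up of `X` at `x` has (`X` integral Noetherian of dimension `≤ 3`).
[cite: GortzWedhorn2020, Def. 13.90, Prop. 13.91] -/
theorem forall_near_two_le_of_isBlowup {X X₁ : Scheme.{0}} [IsIntegral X] [IsNoetherian X] (hX3 : topologicalKrullDim X ≤ 3)
    (J : X.IdealSheafData) (μ : ℕ) (x : X) (hcl : IsClosed ({x} : Set X)) {π : X₁ ⟶ X} (hπ : IsBlowup π (vanishingIdeal ⟨{x}, hcl⟩))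
    (hone : ∀ x' : X₁, IsClosed ({x'} : Set X₁) → π x' = x → idealOrder (controlledTransform π (vanishingIdeal ⟨{x}, hcl⟩) J μ) x' = μ →
      (maximalIdeal (X₁.presheaf.stalk x')).spanFinrank = 3 →
      ∀ hr : IsRegularLocalRing (X₁.presheaf.stalk x'), 2 ≤ @stalkTau X₁ (controlledTransform π (vanishingIdeal ⟨{x}, hcl⟩) J μ) x' hr μ) :
    ∀ (X₂ : Scheme.{0}) (ϖ : X₂ ⟶ X), IsBlowup ϖ (vanishingIdeal ⟨{x}, hcl⟩) →
      ∀ w : X₂, IsClosed ({w} : Set X₂) → ϖ w = x → idealOrder (controlledTransform ϖ (vanishingIdeal ⟨{x}, hcl⟩) J μ) w = μ →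
        (maximalIdeal (X₂.presheaf.stalk w)).spanFinrank = 3 →
        ∀ hr : IsRegularLocalRing (X₂.presheaf.stalk w), 2 ≤ @stalkTau X₂ (controlledTransform ϖ (vanishingIdeal ⟨{x}, hcl⟩) J μ) w hr μ := by
  intro X₂ ϖ hϖ w _ hw hordw hdw hrw
  haveI : IsLocallyNoetherian X₁ := hπ.isLocallyNoetherian
  haveI : IsLocallyNoetherian X₂ := hϖ.isLocallyNoetherian
  set C : X.IdealSheafData := vanishingIdeal (⟨{x}, hcl⟩ : Closeds X) with hCdef
  -- the isomorphism `e : X₂ ≅ X₁` over `X`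
  obtain ⟨e, he, -⟩ := hϖ.unique hπ
  -- controlled transforms match along `e.hom`
  have hsq : e.hom ≫ π = ϖ ≫ 𝟙 X := by rw [he, Category.comp_id]
  have hCT : (controlledTransform π C J μ).comap e.hom = controlledTransform ϖ C J μ := by
    have h := comap_controlledTransform_of_flat (𝟙 X) hsq C J μ
    rwa [Scheme.IdealSheafData.comap_id, Scheme.IdealSheafData.comap_id] at h
  -- the point `e.hom w` of `X₁`
  haveI hiso : IsIso (e.hom.stalkMap w) := inferInstance
  haveI hrx' : IsRegularLocalRing (X₁.presheaf.stalk (e.hom w)) :=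
    IsRegularLocalRing.of_ringEquiv (asIso (e.hom.stalkMap w)).commRingCatIsoToRingEquiv.symm
  have hπx' : π (e.hom w) = x := by rw [← Scheme.Hom.comp_apply, he, hw]
  have hdx' : (maximalIdeal (X₁.presheaf.stalk (e.hom w))).spanFinrank = 3 := by
    rw [← CampaignW46.spanFinrank_eq_of_isIso_stalkMap e.hom w]
    exact hdw
  have hX3₁ : topologicalKrullDim X₁ ≤ 3 := hπ.topologicalKrullDim_le hX3
  have hcoh3₁ : ∀ z : X₁, Order.coheight z ≤ 3 := (topologicalKrullDim_le_iff_forall_coheight_le X₁ 3).mp hX3₁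
  have hcohx' : Order.coheight (e.hom w) = 3 := by
    have h := CampaignW46.coheight_eq_spanFinrank (e.hom w)
    rw [hdx'] at h
    exact_mod_cast h
  have hx'cl : IsClosed ({e.hom w} : Set X₁) := isClosed_singleton_of_coheight_eq_three hcoh3₁ hcohx'
  have hordx' : idealOrder (controlledTransform π C J μ) (e.hom w) = μ := by
    rw [← idealOrder_comap_of_isOpenImmersion e.hom, hCT]
    exact hordw
  have hτx' := hone (e.hom w) hx'cl hπx' hordx' hdx' hrx'
  have hτeq : @stalkTau X₂ (controlledTransform ϖ C J μ) w hrw μ = stalkTau (controlledTransform π C J μ) (e.hom w) μ := by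
    rw [← hCT]
    exact stalkTau_eq_of_isIso_stalkMap e.hom w _ _ (stalkIdeal_comap_eq_map_stalkMap e.hom _ w) μ
  rw [hτeq]
  exact hτx'

end Summit.ResolutionOfSingularities.ResolutionOfSingularities.Theorems.RadicialJung.CleanModels

end
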